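import Mathlib.RingTheory.Kaehler.Basic
import Mathlib.RingTheory.Derivation.Basic
import Mathlib.LinearAlgebra.LinearIndependent.Defs
import HarnessLib

/-!
# Rosenlicht's exposition of Ax's differential algebra, I: the Lie derivative on Kähler
# differentials and the Wronskian lemma

Trunk T-TRANSCEND (`Literature/NumberTheory/Transcendental`). First support file for discharging
the named fact `Literature.NumberTheory.Transcendental.ax_schanuel` (`AxSchanuel.lean`, Ax 1971 Thm. 3), following

* M. Rosenlicht, *On Liouville's theory of elementary functions*, Pacific J. Math. 65 (1976),
  485–492, §1: "a succinct and somewhat simplified treatment of the necessary parts of Ax's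
  paper".

Everything in this file is PROVED (no named facts). With `Ω[S⁄R]` Mathlib's module of Kähler
differentials (`KaehlerDifferential R S`, universal derivation `KaehlerDifferential.D R S`; this is
Rosenlicht's Prop. 1), we formalise:

* **Prop. 2** (the *Lie derivative*). For an `R`-derivation `∂ : S → S` there is a unique additive
  (indeed `R`-linear) map `D¹ = lieDeriv ∂ : Ω[S⁄R] → Ω[S⁄R]` with `D¹(f ω) = (∂f) ω + f D¹ω` and
  `D¹(dy) = d(∂y)` (`lieDeriv_smul`, `lieDeriv_D`). Rosenlicht's construction verbatim: define
  `D¹'(Σ xᵢ δyᵢ) = Σ ((∂xᵢ) dyᵢ + xᵢ d(∂yᵢ))` on the free module `S^{(S)}` (`preLie`) and check that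
  it kills the relations (`preLie_eq_zero_of_mem_kerTotal`, using Mathlib's presentation
  `KaehlerDifferential.kerTotal`).
* **Prop. 5**, in the two special cases used for logarithmic forms: `D¹(dv) = d(∂v)` and
  `D¹(u⁻¹ du) = d(u⁻¹ ∂u)` (`lieDeriv_inv_smul_D`), whence `D¹(u⁻¹du - dv) = 0` as soon as
  `∂u = u ∂v` (`lieDeriv_dlog_sub_eq_zero`: the exponential differential equation).
* **Prop. 6** (Wronskian lemma). If `ω₁, …, ωₙ ∈ Ω` are killed by additive operators `Lⱼ` that
  satisfy the Lie-derivative rule for derivations `∂ⱼ`, and are linearly dependent over the field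
  `K`, then they are linearly dependent over the constants `⋂ⱼ ker ∂ⱼ` — with a relation one of
  whose coefficients is `1` (`exists_const_relation`; stated for any `K`-vector space).
* Logarithmic differentials in `Ω[K⁄R]` for a field `K`: `dlog u = u⁻¹ du`, with
  `dlog (u v) = dlog u + dlog v`, `dlog u⁻¹ = -dlog u`, `dlog (uᵐ) = m • dlog u` (`m : ℤ`),
  `dlog (∏ uᵢ^{mᵢ}) = Σ mᵢ • dlog uᵢ` [folklore].

## References

* M. Rosenlicht, *On Liouville's theory of elementary functions*, Pacific J. Math. 65 (1976),
  no. 2, 485–492, doi:10.2140/pjm.1976.65.485: Props. 1, 2, 5, 6 (pp. 485–488).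
* J. Ax, *On Schanuel's conjectures*, Ann. of Math. 93 (1971), 252–268, §§1–3.
-/

noncomputable section

open KaehlerDifferential Finsupp

namespace Literature.NumberTheory.Transcendental.Rosenlicht

/-! ### Prop. 2: the Lie derivative `D¹` of a derivation on `Ω[S⁄R]` -/

section LieDerivative

variable {R S : Type*} [CommRing R] [CommRing S] [Algebra R S] (δ : Derivation R S S)

/-- Rosenlicht's `D¹'` on the free `S`-module on symbols `δy` (`Finsupp.single y x` stands for
`x δy`): `D¹'(x δy) = (∂x) dy + x d(∂y)`. [cite: Rosenlicht1976, Prop. 2 (proof)] -/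
def preLie : (S →₀ S) →ₗ[R] Ω[S⁄R] :=
  Finsupp.lsum R fun y =>
    { toFun := fun x => δ x • D R S y + x • D R S (δ y)
      map_add' := fun a b => by
        rw [map_add, add_smul, add_smul]; abel
      map_smul' := fun r a => by
        rw [RingHom.id_apply, δ.map_smul, smul_assoc, smul_assoc, smul_add] }

/-- `D¹'(x δy) = (∂x) dy + x d(∂y)`. [cite: Rosenlicht1976, Prop. 2 (proof)] -/
@[simp] theorem preLie_single (y x : S) :
    preLie δ (single y x) = δ x • D R S y + x • D R S (δ y) := by
  simp [preLie]

/-- The twisted `S`-linearity of `D¹'`: `D¹'(s m) = s D¹'(m) + (∂s) π(m)`, where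
`π : S^{(S)} → Ω[S⁄R]` is the canonical surjection `x δy ↦ x dy`.
[cite: Rosenlicht1976, Prop. 2 (proof)] -/
theorem preLie_smul (s : S) (m : S →₀ S) :
    preLie δ (s • m) = s • preLie δ m +
      δ s • Finsupp.linearCombination S (D R S) m := by
  induction m using Finsupp.induction_linear with
  | zero => simp
  | add f g hf hg => rw [smul_add, map_add, hf, hg, map_add, map_add, smul_add, smul_add]; abel
  | single y x =>
    rw [Finsupp.smul_single, preLie_single, preLie_single, Finsupp.linearCombination_single,
      smul_eq_mul, Derivation.leibniz, smul_eq_mul, smul_eq_mul, add_smul, smul_add, mul_smul,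
      mul_smul, mul_smul, smul_comm x (δ s)]
    abel

/-- `D¹'` kills the defining relations of `Ω[S⁄R]` (additivity and Leibniz of `d`, `d r = 0`),
i.e. Mathlib's `KaehlerDifferential.kerTotal`. [cite: Rosenlicht1976, Prop. 2 (proof)] -/
theorem preLie_eq_zero_of_mem_kerTotal {m : S →₀ S} (hm : m ∈ KaehlerDifferential.kerTotal R S) :
    preLie δ m = 0 := by
  induction hm using Submodule.span_induction with
  | mem x hx =>
    rcases hx with ((⟨⟨a, b⟩, rfl⟩ | ⟨⟨a, b⟩, rfl⟩) | ⟨r, rfl⟩)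
    · simp only [map_add, map_sub, preLie_single, Derivation.map_one_eq_zero, zero_smul, one_smul,
        zero_add, Derivation.map_add (D R S)]
      abel
    · simp only [map_add, map_sub, preLie_single, Derivation.map_one_eq_zero, zero_smul, one_smul,
        zero_add, Derivation.leibniz, smul_eq_mul]
      abel
    · simp [preLie_single, Derivation.map_algebraMap]
  | zero => exact map_zero _
  | add x y _ _ hx hy => rw [map_add, hx, hy, add_zero]
  | smul s x hx hx0 =>
    rw [preLie_smul, hx0, smul_zero, zero_add]
    have : Finsupp.linearCombination S (D R S) x = 0 := by
      rw [← LinearMap.mem_ker, KaehlerDifferential.kerTotal_eq]; exact hx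
    rw [this, smul_zero]

/-- `D¹'` only depends on the image in `Ω[S⁄R]`. [cite: Rosenlicht1976, Prop. 2 (proof)] -/
theorem preLie_eq_of_eq {m m' : S →₀ S}
    (h : Finsupp.linearCombination S (D R S) m = Finsupp.linearCombination S (D R S) m') :
    preLie δ m = preLie δ m' := by
  rw [← sub_eq_zero, ← map_sub]
  apply preLie_eq_zero_of_mem_kerTotal
  rw [← KaehlerDifferential.kerTotal_eq, LinearMap.mem_ker, map_sub, h, sub_self]

/-- **Rosenlicht 1976, Prop. 2: the Lie derivative** `D¹ : Ω[S⁄R] → Ω[S⁄R]` of an `R`-derivation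
`∂` of `S` ("there exists a unique map `D¹ : Ω_{K/k} → Ω_{K/k}` such that
`D¹(ω + η) = D¹ω + D¹η`, `D¹(fω) = (Df)ω + f(D¹ω)`, and `D¹(df) = d(Df)`"), as an `R`-linear
map. [cite: Rosenlicht1976, Prop. 2] -/
def lieDeriv : Ω[S⁄R] →ₗ[R] Ω[S⁄R] where
  toFun ω := preLie δ (Classical.choose (KaehlerDifferential.linearCombination_surjective R S ω))
  map_add' ω η := by
    have hω := Classical.choose_spec (KaehlerDifferential.linearCombination_surjective R S ω)
    have hη := Classical.choose_spec (KaehlerDifferential.linearCombination_surjective R S η)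
    have hωη := Classical.choose_spec
      (KaehlerDifferential.linearCombination_surjective R S (ω + η))
    rw [← map_add]
    apply preLie_eq_of_eq
    rw [map_add, hω, hη, hωη]
  map_smul' r ω := by
    have hω := Classical.choose_spec (KaehlerDifferential.linearCombination_surjective R S ω)
    have hrω := Classical.choose_spec
      (KaehlerDifferential.linearCombination_surjective R S (r • ω))
    rw [RingHom.id_apply, ← map_smul]
    apply preLie_eq_of_eq
    rw [LinearMap.map_smul_of_tower, hω, hrω]

/-- `D¹` on an element presented as `Σ xᵢ dyᵢ`. [cite: Rosenlicht1976, Prop. 2] -/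
theorem lieDeriv_linearCombination (m : S →₀ S) :
    lieDeriv δ (Finsupp.linearCombination S (D R S) m) = preLie δ m :=
  preLie_eq_of_eq δ (Classical.choose_spec
    (KaehlerDifferential.linearCombination_surjective R S _))

/-- `D¹(x dy) = (∂x) dy + x d(∂y)`. [cite: Rosenlicht1976, Prop. 2] -/
theorem lieDeriv_smul_D (x y : S) :
    lieDeriv δ (x • D R S y) = δ x • D R S y + x • D R S (δ y) := by
  rw [← Finsupp.linearCombination_single S (v := D R S), lieDeriv_linearCombination, preLie_single]

/-- `D¹(dy) = d(∂y)` (Rosenlicht 1976, Prop. 2). [cite: Rosenlicht1976, Prop. 2] -/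
@[simp] theorem lieDeriv_D (y : S) : lieDeriv δ (D R S y) = D R S (δ y) := by
  simpa using lieDeriv_smul_D δ 1 y

/-- `D¹(f ω) = (∂f) ω + f D¹ω` (Rosenlicht 1976, Prop. 2). [cite: Rosenlicht1976, Prop. 2] -/
theorem lieDeriv_smul (s : S) (ω : Ω[S⁄R]) :
    lieDeriv δ (s • ω) = δ s • ω + s • lieDeriv δ ω := by
  obtain ⟨m, rfl⟩ := KaehlerDifferential.linearCombination_surjective R S ω
  rw [← LinearMap.map_smul, lieDeriv_linearCombination, lieDeriv_linearCombination, preLie_smul,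
    add_comm]

end LieDerivative

/-! ### Prop. 5 (special cases): `D¹` of logarithmic and exact forms -/

section LogForms

variable {R K : Type*} [CommRing R] [Field K] [Algebra R K] (δ : Derivation R K K)

/-- `D¹(u⁻¹ du) = d(u⁻¹ ∂u)`: the instance of Rosenlicht 1976, Prop. 5 (`D¹(u dt) = d(u Dt)` for
`u, t` algebraically dependent over the constants; here the pair `u⁻¹, u`) needed for logarithmic
differentials. Direct computation with `∂(u⁻¹) = -u⁻² ∂u`. [cite: Rosenlicht1976, Prop. 5] -/
theorem lieDeriv_inv_smul_D (u : K) :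
    lieDeriv δ (u⁻¹ • D R K u) = D R K (u⁻¹ * δ u) := by
  rw [lieDeriv_smul_D, (D R K).leibniz, δ.leibniz_inv, (D R K).leibniz_inv]
  simp only [smul_eq_mul, smul_smul, neg_mul, neg_smul, smul_neg]
  rw [mul_comm (δ u)]
  abel

/-- If `∂u = u ∂v` (the exponential differential equation "`u = eᵛ`") with `u ≠ 0`, then the form
`u⁻¹ du - dv` is killed by `D¹`: `D¹(u⁻¹du - dv) = d(u⁻¹∂u - ∂v) = d 0 = 0` (Rosenlicht 1976,
proof of Thm. 1, from Props. 2 and 5). [cite: Rosenlicht1976, Thm. 1 (proof)] -/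
theorem lieDeriv_dlog_sub_eq_zero {u v : K} (hu : u ≠ 0) (h : δ u = u * δ v) :
    lieDeriv δ (u⁻¹ • D R K u - D R K v) = 0 := by
  rw [map_sub, lieDeriv_inv_smul_D, lieDeriv_D, ← map_sub, h, ← mul_assoc, inv_mul_cancel₀ hu,
    one_mul, sub_self, map_zero]

end LogForms

/-! ### Prop. 6: the Wronskian lemma -/

section Wronskian

variable {K V : Type*} [Field K] [AddCommGroup V] [Module K V]

/-- **Rosenlicht 1976, Prop. 6** ("Suppose `ω₁, …, ωₙ ∈ Ω_{K/k}` are annulled by each `D¹` for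
`D ∈ Δ`. Then if `ω₁, …, ωₙ` are linearly dependent over `K` they are linearly dependent over
`C = ⋂_{D ∈ Δ} ker D`"), in abstract form: `V` is a `K`-vector space, `∂ⱼ : K → K` are additive
maps with `∂ⱼ 1 = 0`, and `Lⱼ : V → V` are additive operators with the Lie-derivative rule
`Lⱼ(a v) = (∂ⱼa) v + a Lⱼ v`. If the `ωᵢ` are killed by all `Lⱼ` and are `K`-linearly dependent,
there is a relation `Σ bᵢ ωᵢ = 0` with all `bᵢ` constants (`∂ⱼ bᵢ = 0` for all `j`) and some
`bᵢ = 1`. Proof as printed: a relation of minimal support, normalised to have a coefficient `1`,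
is mapped by `Lⱼ` to the shorter relation `Σ (∂ⱼbᵢ) ωᵢ = 0`, which must therefore vanish.
[cite: Rosenlicht1976, Prop. 6] -/
theorem exists_const_relation {ι J : Type*} [Fintype ι] (δ : J → K →+ K) (h1 : ∀ j, δ j 1 = 0)
    (L : J → V →+ V) (hL : ∀ j (a : K) (v : V), L j (a • v) = δ j a • v + a • L j v)
    (ω : ι → V) (hω : ∀ j i, L j (ω i) = 0) (hdep : ¬ LinearIndependent K ω) :
    ∃ b : ι → K, (∃ i, b i = 1) ∧ (∀ j i, δ j (b i) = 0) ∧ ∑ i, b i • ω i = 0 := by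
  classical
  -- relations and their support size
  let Rel : (ι → K) → Prop := fun a => (∃ i, a i ≠ 0) ∧ ∑ i, a i • ω i = 0
  let sz : (ι → K) → ℕ := fun a => (Finset.univ.filter fun i => a i ≠ 0).card
  have hex : ∃ N, ∃ a, Rel a ∧ sz a = N := by
    obtain ⟨g, hg, i, hi⟩ := Fintype.not_linearIndependent_iff.mp hdep
    exact ⟨sz g, g, ⟨⟨i, hi⟩, hg⟩, rfl⟩
  obtain ⟨a, ⟨⟨i₀, hi₀⟩, ha⟩, hsz⟩ := Nat.find_spec hex
  have hmin : ∀ a', Rel a' → sz a ≤ sz a' := fun a' ha' => by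
    rw [hsz]; exact Nat.find_min' hex ⟨a', ha', rfl⟩
  -- normalise
  let b : ι → K := fun i => (a i₀)⁻¹ * a i
  have hb0 : b i₀ = 1 := inv_mul_cancel₀ hi₀
  have hb : ∑ i, b i • ω i = 0 := by
    simp only [b, mul_smul, ← Finset.smul_sum, ha, smul_zero]
  have hbsupp : ∀ i, b i ≠ 0 ↔ a i ≠ 0 := fun i => by
    simp only [b, ne_eq, mul_eq_zero, inv_eq_zero, hi₀, false_or]
  have hszb : sz b = sz a := by
    simp only [sz]
    congr 1
    ext i
    simp only [Finset.mem_filter, Finset.mem_univ, true_and, hbsupp]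
  refine ⟨b, ⟨i₀, hb0⟩, fun j => ?_, hb⟩
  -- apply `L j`
  let b' : ι → K := fun i => δ j (b i)
  have hb' : ∑ i, b' i • ω i = 0 := by
    have := congrArg (L j) hb
    rw [map_sum, map_zero] at this
    simpa only [hL, hω, smul_zero, add_zero] using this
  by_contra hne
  push Not at hne
  obtain ⟨i₁, hi₁⟩ := hne
  have hRel : Rel b' := ⟨⟨i₁, hi₁⟩, hb'⟩
  have hlt : sz b' < sz b := by
    apply Finset.card_lt_card
    rw [Finset.ssubset_iff_of_subset]
    · refine ⟨i₀, ?_, ?_⟩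
      · simp [hb0]
      · simp [b', hb0, h1]
    · intro i hi
      simp only [Finset.mem_filter, Finset.mem_univ, true_and] at hi ⊢
      intro h0
      apply hi
      simp [b', h0]
  have := hmin b' hRel
  rw [← hszb] at this
  exact absurd hlt (not_lt.mpr this)

/-- The Wronskian lemma for the Lie derivatives of a family of derivations `∂ⱼ` of a field `K`
over `R`, acting on `Ω[K⁄R]` (Rosenlicht 1976, Prop. 6, as printed): forms killed by every `D¹ⱼ`
that are `K`-linearly dependent admit a relation with coefficients in `⋂ⱼ ker ∂ⱼ`, one of them
equal to `1`. [cite: Rosenlicht1976, Prop. 6] -/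
theorem exists_const_relation_lieDeriv {R : Type*} [CommRing R] [Algebra R K] {ι J : Type*}
    [Fintype ι] (δ : J → Derivation R K K) (ω : ι → Ω[K⁄R])
    (hω : ∀ j i, lieDeriv (δ j) (ω i) = 0) (hdep : ¬ LinearIndependent K ω) :
    ∃ b : ι → K, (∃ i, b i = 1) ∧ (∀ j i, δ j (b i) = 0) ∧ ∑ i, b i • ω i = 0 :=
  exists_const_relation (fun j => (δ j : K →+ K)) (fun j => (δ j).map_one_eq_zero)
    (fun j => (lieDeriv (δ j)).toAddMonoidHom) (fun j a v => lieDeriv_smul (δ j) a v) ω hω hdep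

end Wronskian

/-! ### Logarithmic differentials -/

section Dlog

variable {R K : Type*} [CommRing R] [Field K] [Algebra R K]

/-- The logarithmic differential `dlog u = u⁻¹ du ∈ Ω[K⁄R]` (`= 0` for `u = 0`). [folklore] -/
def dlog (u : K) : Ω[K⁄R] := u⁻¹ • D R K u

/-- Unfolding `dlog`. [folklore] -/
theorem dlog_def (u : K) : (dlog u : Ω[K⁄R]) = u⁻¹ • D R K u := rfl

/-- `dlog 1 = 0`. [folklore] -/
@[simp] theorem dlog_one : (dlog (1 : K) : Ω[K⁄R]) = 0 := by
  simp [dlog, Derivation.map_one_eq_zero]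

/-- `dlog (u v) = dlog u + dlog v` for `u, v ≠ 0`. [folklore] -/
theorem dlog_mul {u v : K} (hu : u ≠ 0) (hv : v ≠ 0) :
    (dlog (u * v) : Ω[K⁄R]) = dlog u + dlog v := by
  have h1 : (u * v)⁻¹ * u = v⁻¹ := by rw [mul_inv_rev, mul_assoc, inv_mul_cancel₀ hu, mul_one]
  have h2 : (u * v)⁻¹ * v = u⁻¹ := by
    rw [mul_inv_rev, mul_comm v⁻¹, mul_assoc, inv_mul_cancel₀ hv, mul_one]
  rw [dlog, dlog, dlog, (D R K).leibniz, smul_add, smul_smul, smul_smul, h1, h2, add_comm]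

/-- `dlog u⁻¹ = -dlog u`. [folklore] -/
theorem dlog_inv (u : K) : (dlog u⁻¹ : Ω[K⁄R]) = -dlog u := by
  rcases eq_or_ne u 0 with rfl | hu
  · simp [dlog]
  · simp only [dlog, (D R K).leibniz_inv, inv_inv, smul_smul, smul_neg, neg_smul, neg_inj, sq]
    rw [← mul_assoc, mul_inv_cancel₀ hu, one_mul]

/-- `dlog (uⁿ) = n • dlog u` for `n : ℕ`. [folklore] -/
theorem dlog_pow (u : K) (n : ℕ) : (dlog (u ^ n) : Ω[K⁄R]) = n • dlog u := by
  rcases eq_or_ne u 0 with rfl | hu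
  · rcases Nat.eq_zero_or_pos n with rfl | hn
    · simp
    · simp [dlog, zero_pow hn.ne']
  · induction n with
    | zero => simp
    | succ n ih => rw [pow_succ, dlog_mul (pow_ne_zero n hu) hu, ih, add_smul, one_smul]

/-- `dlog (uᵐ) = m • dlog u` for `m : ℤ`. [folklore] -/
theorem dlog_zpow (u : K) (m : ℤ) : (dlog (u ^ m) : Ω[K⁄R]) = m • dlog u := by
  cases m with
  | ofNat n => rw [Int.ofNat_eq_natCast, zpow_natCast, dlog_pow, natCast_zsmul]
  | negSucc n => rw [zpow_negSucc, dlog_inv, dlog_pow, negSucc_zsmul]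

/-- `dlog (∏ᵢ uᵢ ^ mᵢ) = Σᵢ mᵢ • dlog uᵢ` for non-zero `uᵢ` and integer exponents. [folklore] -/
theorem dlog_prod_zpow {ι : Type*} (s : Finset ι) (u : ι → K) (hu : ∀ i ∈ s, u i ≠ 0)
    (m : ι → ℤ) : (dlog (∏ i ∈ s, u i ^ m i) : Ω[K⁄R]) = ∑ i ∈ s, m i • dlog (u i) := by
  classical
  induction s using Finset.induction_on with
  | empty => simp
  | insert a s ha ih =>
    rw [Finset.prod_insert ha, Finset.sum_insert ha,
      dlog_mul (zpow_ne_zero _ (hu a (Finset.mem_insert_self a s)))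
        (Finset.prod_ne_zero_iff.mpr fun i hi => zpow_ne_zero _
          (hu i (Finset.mem_insert_of_mem hi))),
      dlog_zpow, ih fun i hi => hu i (Finset.mem_insert_of_mem hi)]

/-- A derivation `∂` of `K` over `R` pairs with `dlog u` to the logarithmic derivative:
`∂*(dlog u) = u⁻¹ ∂u`. [folklore] -/
theorem liftKaehlerDifferential_dlog (δ : Derivation R K K) (u : K) :
    δ.liftKaehlerDifferential (dlog u) = u⁻¹ * δ u := by
  rw [dlog, map_smul, Derivation.liftKaehlerDifferential_comp_D, smul_eq_mul]

end Dlog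

end Literature.NumberTheory.Transcendental.Rosenlicht

end
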